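import Mathlib
import Summits.NavierStokesRegularity.NavierStokesRegularity.Theorems.LerayQuarterDissipationFiniteDissipationLiouvilleCriticalProductionLaw
import Summits.NavierStokesRegularity.NavierStokesRegularity.Theorems.LerayQuarterDissipationFiniteDissipationLiouvilleCriticalProductionApex
import HarnessLib

/-!
# Route `LerayQuarterDissipation`, crux `FiniteDissipationLiouville` (stmt-NavierStokesRegularity-22144), line `birth` —
# THE BORDERLINE ROW NEAR THE APEX: `t²|ω|²` sub-caloric on `[τ, 0) × ℝ³` forbids the singularity (finite dissipation)

Seat ns-lqd-lead g18 (LEAD of 22144, cell ns-idea-3; helper `--supports` 22144).  The all-time borderline row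
`…CriticalProductionLaw.eq_zero_of_enstrophy_subsolution_of_law` (KNSS-gauge Type-I + dissipation law +
`(−t)(⟪ω, DV ω⟫ − |∇ω|²_F) ≤ |ω|²` everywhere ⇒ `V ≡ 0`) made EVENTUAL towards the apex, exactly as
`…CriticalProductionApex` did for the credit family: the zoom-in sequence keeps class, law and singularity, satisfies
the hypothesis on windows `[τe^{2j}, 0)`, and its KNSS limit is singular (`…Compactness.persistent_singularity_seq`),
carries the law (`dissipationLaw_of_tendsto_fderiv`, Fatou) and the hypothesis everywhere
(`critProdCredit_of_limit_eventually` with `a = 1`) — so it vanishes, absurd.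

* **`not_singular_of_enstrophy_subsolution_near_apex`**;
* PORTRAIT `subsolution_fails_near_apex_of_singular` — a singular element of the crux's class 𝒟 has, for every
  `τ < 0`, a point `(s, y)` with `τ ≤ s < 0` and `|ω|² < (−s)(⟪ω, DV ω⟫ − |∇ω|²_F)`: the points where the
  scale-invariant enstrophy density is strictly super-caloric along the flow ACCUMULATE AT THE APEX.

WHAT THIS IS NOT: not a claim about Navier–Stokes regularity and not the crux — a regularity criterion / portrait
clause for the hypothetical singular element (bears_on LADDER-NS N0).
-/

noncomputable section

-- the summit and its single sub-problem share the name (CONVENTIONS §1), as in every Theorems file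
set_option linter.dupNamespace false

namespace Summit.NavierStokesRegularity.NavierStokesRegularity.Theorems.FiniteDissipationLiouville.CriticalProduction

open MeasureTheory Set Function Filter Topology TopologicalSpace Metric InnerProductSpace
open scoped RealInnerProductSpace InnerProductSpace ContDiff ENNReal
open Literature.Analysis Literature.Analysis.FluidPDE
open Summit.NavierStokesRegularity.NavierStokesRegularity.Theorems
open Summit.NavierStokesRegularity.NavierStokesRegularity.Theorems.RecurrentReductionD
open Summit.NavierStokesRegularity.NavierStokesRegularity.Theorems.FiniteDissipationLiouville.EndpointScheme

variable {C : ℝ} {V : ℝ → EuclideanSpace ℝ (Fin 3) → EuclideanSpace ℝ (Fin 3)}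

/-- **`t²|ω|²` SUB-CALORIC NEAR THE APEX FORBIDS THE SINGULARITY (finite dissipation).**  `IsTypeIAncientMild C V`,
the dissipation law `∫|∇V(s)|² ≤ K/√(−s)`, and `(−s)(⟪ω, DV ω⟫ − |∇ω|²_F)(s, y) ≤ |ω(s, y)|²` for all `τ ≤ s < 0`,
`y` (some `τ < 0`) ⇒ `V` is not singular at the space-time origin. [cite: KochNadirashviliSereginSverak2009, Prop. 4.1 (arXiv:0709.3599)] -/
theorem not_singular_of_enstrophy_subsolution_near_apex {K : ℝ} (hV : IsTypeIAncientMild C V)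
    (hlaw : ∀ s : ℝ, s < 0 → ∫⁻ x, ‖fderiv ℝ (V s) x‖ₑ ^ 2 ≤ ENNReal.ofReal (K / Real.sqrt (-s)))
    {τ : ℝ} (hτ : τ < 0)
    (hP : ∀ s : ℝ, τ ≤ s → s < 0 → ∀ y, (-s) * (⟪curl (V s) y, fderiv ℝ (V s) y (curl (V s) y)⟫_ℝ
        - frobeniusNormSq (fderiv ℝ (curl (V s)) y)) ≤ ⟪curl (V s) y, curl (V s) y⟫_ℝ) :
    ¬ (∀ r > 0, ∀ M : ℝ, ∃ t ∈ Ioo (-(r ^ 2)) (0 : ℝ),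
      ∃ x ∈ ball (0 : EuclideanSpace ℝ (Fin 3)) r, M < ‖V t x‖) := by
  -- adapted from `not_singular_of_critProdCredit_near_apex` (this line, p718801)
  intro hsing
  have hP1 : ∀ s : ℝ, τ ≤ s → s < 0 → ∀ y, (-s) * (⟪curl (V s) y, fderiv ℝ (V s) y (curl (V s) y)⟫_ℝ
      - 1 * frobeniusNormSq (fderiv ℝ (curl (V s)) y)) ≤ ⟪curl (V s) y, curl (V s) y⟫_ℝ :=
    fun s h1 h2 y => by rw [one_mul]; exact hP s h1 h2 y
  -- the zoom-IN sequence: class, law, singularity, windows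
  obtain ⟨u, hudef⟩ : ∃ u : ℕ → ℝ → EuclideanSpace ℝ (Fin 3) → EuclideanSpace ℝ (Fin 3),
      ∀ j, u j = nsRescale (Real.exp (-(j : ℝ))) V := ⟨_, fun j => rfl⟩
  have hu : ∀ j, IsTypeIAncientMild C (u j) := fun j => by
    rw [hudef]; exact hV.nsRescale (Real.exp_pos _)
  have hlawu : ∀ j, ∀ s : ℝ, s < 0 →
      ∫⁻ x, ‖fderiv ℝ (u j s) x‖ₑ ^ 2 ≤ ENNReal.ofReal (K / Real.sqrt (-s)) := fun j => by
    rw [hudef]; exact dissipationLaw_nsRescale hlaw (Real.exp_pos _)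
  have hsu : ∀ j, ∀ r > 0, ∀ M : ℝ, ∃ t ∈ Ioo (-(r ^ 2)) (0 : ℝ),
      ∃ x ∈ ball (0 : EuclideanSpace ℝ (Fin 3)) r, M < ‖u j t x‖ := fun j => by
    rw [hudef]; exact singularAtOrigin_nsRescale hsing (Real.exp_pos _)
  have hPu : ∀ j : ℕ, ∀ s : ℝ, τ / Real.exp (-(j : ℝ)) ^ 2 ≤ s → s < 0 → ∀ y,
      (-s) * (⟪curl (u j s) y, fderiv ℝ (u j s) y (curl (u j s) y)⟫_ℝ
        - 1 * frobeniusNormSq (fderiv ℝ (curl (u j s)) y)) ≤ ⟪curl (u j s) y, curl (u j s) y⟫_ℝ := fun j => by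
    rw [hudef]; exact critProdCredit_nsRescale_from (Real.exp_pos _) hP1
  -- its KNSS limit: singular, with the law and the all-time property
  obtain ⟨ψ, hψ, W, hW, hunif, hpt, hgr⟩ := Compactness.seqLimit hu
  have hψr : Tendsto (fun j => ((ψ j : ℕ) : ℝ)) atTop atTop :=
    tendsto_natCast_atTop_atTop.comp hψ.tendsto_atTop
  have hWsing := Compactness.persistent_singularity_seq (w := fun j => u (ψ j))
    (fun j => hu _) (fun j => hlawu _) (fun j => hsu _) hW hunif
  have hlawW : ∀ s : ℝ, s < 0 → ∫⁻ x, ‖fderiv ℝ (W s) x‖ₑ ^ 2 ≤ ENNReal.ofReal (K / Real.sqrt (-s)) :=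
    dissipationLaw_of_tendsto_fderiv (fun j => hlawu (ψ j)) hgr
  have hτj : Tendsto (fun j => τ / Real.exp (-((ψ j : ℕ) : ℝ)) ^ 2) atTop atBot := by
    have e : ∀ j, τ / Real.exp (-((ψ j : ℕ) : ℝ)) ^ 2 = τ * Real.exp (2 * ((ψ j : ℕ) : ℝ)) := by
      intro j
      rw [div_eq_mul_inv, ← Real.exp_nat_mul, ← Real.exp_neg]
      congr 1; push_cast; ring_nf
    simp_rw [e]
    have h2 : Tendsto (fun j => Real.exp (2 * ((ψ j : ℕ) : ℝ))) atTop atTop :=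
      Real.tendsto_exp_atTop.comp (hψr.const_mul_atTop (by norm_num))
    exact h2.const_mul_atTop_of_neg hτ
  have hPW := critProdCredit_of_limit_eventually (w := fun j => u (ψ j)) (fun j => hu _) hW hunif hgr hτj
    (fun j => hPu (ψ j))
  have hW0 : ∀ t < 0, ∀ x, W t x = 0 := eq_zero_of_enstrophy_subsolution_of_law hW hlawW hPW
  -- contradiction
  obtain ⟨t, ht, x, -, hM⟩ := hWsing 1 one_pos 0
  rw [hW0 t ht.2 x, norm_zero] at hM
  exact lt_irrefl _ hM

/-- **PORTRAIT: the super-caloric points of `t²|ω|²` accumulate at the apex.**  A finite-dissipation KNSS-gauge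
Type-I field singular at the origin has, for every `τ < 0`, a point `(s, y)` with `τ ≤ s < 0` and
`|ω(s,y)|² < (−s)(⟪ω, DV ω⟫ − |∇ω|²_F)(s, y)`. [cite: KochNadirashviliSereginSverak2009, Prop. 4.1 (arXiv:0709.3599)] -/
theorem subsolution_fails_near_apex_of_singular {K : ℝ} (hV : IsTypeIAncientMild C V)
    (hlaw : ∀ s : ℝ, s < 0 → ∫⁻ x, ‖fderiv ℝ (V s) x‖ₑ ^ 2 ≤ ENNReal.ofReal (K / Real.sqrt (-s)))
    (hsing : ∀ r > 0, ∀ M : ℝ, ∃ t ∈ Ioo (-(r ^ 2)) (0 : ℝ),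
        ∃ x ∈ ball (0 : EuclideanSpace ℝ (Fin 3)) r, M < ‖V t x‖)
    {τ : ℝ} (hτ : τ < 0) :
    ∃ s : ℝ, τ ≤ s ∧ s < 0 ∧ ∃ y : EuclideanSpace ℝ (Fin 3),
      ⟪curl (V s) y, curl (V s) y⟫_ℝ < (-s) * (⟪curl (V s) y, fderiv ℝ (V s) y (curl (V s) y)⟫_ℝ
        - frobeniusNormSq (fderiv ℝ (curl (V s)) y)) := by
  by_contra h
  push Not at h
  exact not_singular_of_enstrophy_subsolution_near_apex hV hlaw hτ (fun s h1 h2 y => h s h1 h2 y) hsing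

end Summit.NavierStokesRegularity.NavierStokesRegularity.Theorems.FiniteDissipationLiouville.CriticalProduction

end
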